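import Summits.ValiantsHypothesis.ValiantsHypothesis.Theorems.BarrierLeverSuccinctHittingSetsForVPStubSigmaLambdaSigma
import Summits.ValiantsHypothesis.ValiantsHypothesis.Theorems.BarrierLeverNaturalProofsAgainstAllLinearSizesOfCountSize
import Summits.ValiantsHypothesis.ValiantsHypothesis.Theorems.BarrierLeverSingleSizeEquationsReductions
import Literature.Barriers.ValiantsHypothesis.PartialDerivativesDetPerm
import Literature.Barriers.ValiantsHypothesis.AlgebraicNaturalProofs

/-!
# Route BarrierLever — the MODEL axis of crux `DefinableEquations` (stmt-ValiantsHypothesis-8745) /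
# item `SingleSizeEquations` (8749): the crux's EXACT quantifier shape `∃ a ∀ b` holds on the
# diagonal depth-3 (`ΣΛΣ`, Waring) slice — part 1/2: the certificate and its vanishing

The crux asks for ONE level `a` such that for EVERY size exponent `b`, eventually in `n`, a
nonzero level-`a` boolean sum in the `N = C(2n,n)` coefficient variables vanishes on the
coefficient vectors of a class of `n`-variate polynomials of degree `≤ n` — there the class is
`SmallCircuits ℂ n b` (open: Chatterjee–Tengse 2023 §1.3 dir. 2).  This file proves the same
sentence, with the same quantifier order, for the class
`sigmaLambdaSigmaSlice n (n^b)` of sums of at most `n^b` powers (of degree `≤ n`) of affine forms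
(diagonal depth-3 circuits of top fan-in `n^b`; Waring-type decompositions):
`naturalProofsAgainstSigmaLambdaSigma` (level `a = 18`, `q = 0` boolean variables) and the
boolean-sum form `sigmaLambdaSigmaSliceEquations`.

Certificate (`slsCert n`, Sylvester's catalecticant made square-free): the determinant of the
`2^{⌊n/2⌋} × 2^{⌊n/2⌋}` matrix indexed by subsets `S, T ⊆ {0,…,⌊n/2⌋-1}` with entries
`w(S,T) · c_{x^S x^T}` (`w(S,T) = 2^{|S ∩ T|}`, the descending-factorial weight of the apolarity
action `x^S ⌟ ·`).  VANISHING (`eval_slsCert_eq_zero`): the row of `S` at `coeff f` is the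
square-free coefficient vector of `x^S ⌟ f` (`coeff_apolarAction_monomial_one`), and by the tree's
partial-derivative lemma for diagonal circuits (`SuccinctHittingSetsForVP.stub_sigmaLambdaSigma`,
crux 14610 line `registered`, Nisan–Wigderson 1996) all `x^S ⌟ f` lie in a space of dimension
`≤ Σ_i (d_i + 1) ≤ s (n + 1) < 2^{⌊n/2⌋}`, so the rows are dependent
(`det_eq_zero_of_rows_mem_submodule`).  NON-VANISHING (`eval_slsCert_sqWitness_ne_zero`): at
`F = Σ_S x^{2S}` (degree `≤ n`) the matrix is diagonal with entries `2^{|S|}`.  CONSTRUCTIVITY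
(`slsCert_mem_distinguishers`): size `≤ 8 (2^{⌊n/2⌋}+1)⁷ + 2^{n}`, degree `≤ 2^{⌊n/2⌋}`, both
`≤ N^{18}`; the threshold `n^b (n+1) < 2^{⌊n/2⌋}` holds for `n ≥ 2 · 4^{b+2}`
(`pow_lt_two_pow_of_le`).
WHAT THIS IS NOT: nothing on general circuits (the crux), on homogeneous `ΣΠΣ`, formulas beyond
`n²/20` (see `…FormulaSlice*`), 8746, 14610 or VP vs VNP; classical mathematics (Sylvester 1851,
Iarrobino–Kanev 1999, Nisan–Wigderson 1996) made FSV-natural and kernel-checked.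
-/

-- layout Summits/ValiantsHypothesis/ValiantsHypothesis forces the duplicated namespace component
set_option linter.dupNamespace false

noncomputable section

open MvPolynomial Finsupp

namespace Summit.ValiantsHypothesis.ValiantsHypothesis.Theorems.BarrierLever.SigmaLambdaSigmaSlice

open Literature.Computability.AlgebraicComplexity Literature.Barriers.ValiantsHypothesis

/-! ## Generalities: coefficients of `x^α ⌟ f`, singular matrices, `n^c < 2^n` -/


/-- Coefficients of the apolarity action of a monomial operator:
`(x^α ⌟ f)_β = f_{β+α} · ∏_{i ∈ supp α} (β+α)_i^{(α_i)}` (descending factorials).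
[cite: IarrobinoKanev1999, §1.1] -/
theorem coeff_apolarAction_monomial_one {σ : Type*} [DecidableEq σ] (α β : σ →₀ ℕ)
    (f : MvPolynomial σ ℂ) :
    coeff β (apolarAction (monomial α 1) f) =
      coeff (β + α) f * ∏ i ∈ α.support, (((β + α) i).descFactorial (α i) : ℂ) := by
  classical
  conv_lhs => rw [as_sum f]
  rw [apolarAction_sum_right, coeff_sum]
  simp only [apolarAction_monomial_monomial, one_mul, coeff_monomial]
  rw [Finset.sum_eq_single (β + α)]
  · rw [if_pos (add_tsub_cancel_right β α)]
  · intro d _ hne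
    split_ifs with h
    · obtain ⟨i, hi⟩ : ∃ i, d i < α i := by
        by_contra hcon
        push Not at hcon
        apply hne
        ext j
        have h1 := DFunLike.congr_fun h j
        rw [Finsupp.tsub_apply] at h1
        rw [Finsupp.add_apply]
        have h2 := hcon j
        omega
      have hiα : i ∈ α.support := Finsupp.mem_support_iff.mpr (by omega)
      rw [Finset.prod_eq_zero hiα (by rw [Nat.descFactorial_eq_zero_iff_lt.mpr hi, Nat.cast_zero]),
        mul_zero]
    · rfl
  · intro hn
    rw [if_pos (add_tsub_cancel_right β α), MvPolynomial.notMem_support_iff.1 hn, zero_mul]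

/-- A square matrix whose rows lie in a subspace of dimension smaller than the number of rows is
singular. [folklore] -/
theorem det_eq_zero_of_rows_mem_submodule {F : Type*} [Field F] {R : Type*} [Fintype R]
    [DecidableEq R] (M : Matrix R R F) (W : Submodule F (R → F)) [FiniteDimensional F W]
    (hW : Module.finrank F W < Fintype.card R) (hM : ∀ i, M i ∈ W) : M.det = 0 := by
  by_contra hdet
  have hli := Matrix.linearIndependent_rows_of_det_ne_zero hdet
  let f : R → W := fun i => ⟨M i, hM i⟩
  have hli' : LinearIndependent F f := LinearIndependent.of_comp W.subtype hli
  have h1 := hli'.fintype_card_le_finrank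
  omega

/-- `n^c < 2^n` as soon as `n ≥ 4^c`. [folklore] -/
theorem pow_lt_two_pow_of_le (c n : ℕ) (hn : 4 ^ c ≤ n) : n ^ c < 2 ^ n := by
  have hn0 : n ≠ 0 := by have := Nat.one_le_pow c 4 (by norm_num); omega
  rcases Nat.eq_zero_or_pos c with rfl | hc
  · simpa using Nat.one_lt_two_pow hn0
  -- `2^L ≤ n < 2^(L+1)` and `L ≥ 2c`
  have h1 : n < 2 ^ (Nat.log 2 n + 1) := Nat.lt_pow_succ_log_self (by norm_num) n
  have h2 : 2 ^ Nat.log 2 n ≤ n := Nat.pow_log_le_self 2 hn0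
  have hL2c : 2 * c ≤ Nat.log 2 n := by
    have : 2 ^ (2 * c) ≤ n := by rw [pow_mul]; simpa using hn
    exact Nat.le_log_of_pow_le (by norm_num) this
  -- write `L = c + t` with `t ≥ c`
  obtain ⟨t, ht⟩ : ∃ t, Nat.log 2 n = c + t := ⟨Nat.log 2 n - c, by omega⟩
  rw [ht] at h1 h2 hL2c
  have ht2 : t + 1 ≤ 2 ^ t := Nat.lt_two_pow_self
  have h2c : ∀ m : ℕ, 2 * m ≤ 2 ^ m := by
    intro m
    induction m with
    | zero => simp
    | succ k ih =>
      rcases Nat.eq_zero_or_pos k with rfl | hk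
      · norm_num
      · rw [pow_succ]; omega
  have key : c * (c + t + 1) ≤ 2 ^ (c + t) := by
    rw [pow_add]
    calc c * (c + t + 1) ≤ c * (2 * (t + 1)) := Nat.mul_le_mul_left c (by omega)
      _ = (2 * c) * (t + 1) := by ring
      _ ≤ 2 ^ c * 2 ^ t := Nat.mul_le_mul (h2c c) ht2
  calc n ^ c < (2 ^ (c + t + 1)) ^ c := Nat.pow_lt_pow_left h1 (by omega)
    _ = 2 ^ (c * (c + t + 1)) := by rw [← pow_mul, mul_comm]
    _ ≤ 2 ^ (2 ^ (c + t)) := Nat.pow_le_pow_right (by norm_num) key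
    _ ≤ 2 ^ n := Nat.pow_le_pow_right (by norm_num) h2

/-! ## The slice and the certificate -/

section slice

variable (n : ℕ)

/-- **The diagonal depth-3 slice** (`ΣΛΣ` of top fan-in `≤ s`, formal degree `≤ n`): sums of at
most `s` powers `L_i^{d_i}`, `d_i ≤ n`, of affine forms `L_i` in `x_0,…,x_{n-1}` over `ℂ`
(the shape of the tree's `stub_sigmaLambdaSigma`, all variables allowed). [cite: NisanWigderson1996, §3] -/
def sigmaLambdaSigmaSlice (s : ℕ) : Set (MvPolynomial (Fin n) ℂ) :=
  {f | ∃ (c a₀ : Fin s → ℂ) (a : Fin s → Fin n → ℂ) (d : Fin s → ℕ), (∀ i, d i ≤ n) ∧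
    f = ∑ i : Fin s, C (c i) *
      (C (a₀ i) + ∑ μ ∈ (Finset.univ : Finset (Fin n)), C (a i μ) * X μ) ^ (d i)}

/-- The first `⌊n/2⌋` variables. [folklore] -/
def halfEmb : Fin (n / 2) ↪ Fin n := ⟨Fin.castLE (Nat.div_le_self n 2), Fin.castLE_injective _⟩

/-- The square-free exponent vector `x^S = ∏_{i ∈ S} x_i` of a set `S` of the first `⌊n/2⌋`
variables. [folklore] -/
def ind (S : Finset (Fin (n / 2))) : Fin n →₀ ℕ := sqfree (S.map (halfEmb n))

/-- Values of `ind S` on the first half. [folklore] -/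
theorem ind_apply_halfEmb (S : Finset (Fin (n / 2))) (i : Fin (n / 2)) :
    ind n S (halfEmb n i) = if i ∈ S then 1 else 0 := by
  classical
  simp [ind, sqfree_apply, Finset.mem_map']

/-- Values of `ind S` are `0` or `1`. [folklore] -/
theorem ind_apply_le_one (S : Finset (Fin (n / 2))) (v : Fin n) : ind n S v ≤ 1 := by
  classical
  rw [ind, sqfree_apply]
  split_ifs <;> omega

/-- The degree of a square-free monomial is the size of its support set. [folklore] -/
theorem degree_sqfree {σ : Type*} [DecidableEq σ] (A : Finset σ) : (sqfree A).degree = A.card := by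
  rw [sqfree, map_sum]
  simp

/-- `deg (x^S x^T) = |S| + |T| ≤ n`. [folklore] -/
theorem degree_ind_add_ind_le (S T : Finset (Fin (n / 2))) : (ind n T + ind n S).degree ≤ n := by
  classical
  rw [map_add, ind, ind, degree_sqfree, degree_sqfree, Finset.card_map, Finset.card_map]
  have h1 : T.card ≤ n / 2 := (Finset.card_le_univ T).trans (by rw [Fintype.card_fin])
  have h2 : S.card ≤ n / 2 := (Finset.card_le_univ S).trans (by rw [Fintype.card_fin])
  omega

/-- The coefficient coordinate `c_{x^S x^T}`. [folklore] -/
def slsCoord (S T : Finset (Fin (n / 2))) : degLEMonomials n :=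
  ⟨ind n T + ind n S, degree_ind_add_ind_le n S T⟩

/-- The descending-factorial weight `w(S,T) = ∏_{i ∈ S} (x^S x^T)_i^{(1)} = 2^{|S ∩ T|}` of the
apolarity action `x^S ⌟ ·` on the coordinate `c_{x^S x^T}`. [cite: IarrobinoKanev1999, §1.1] -/
def slsWeight (S T : Finset (Fin (n / 2))) : ℕ :=
  ∏ i ∈ (ind n S).support, ((ind n T + ind n S) i).descFactorial (ind n S i)

/-- **The square-free catalecticant of coefficient variables**: rows and columns indexed by the
subsets of the first `⌊n/2⌋` variables, entry `w(S,T) · c_{x^S x^T}`. [cite: IarrobinoKanev1999, §1.1] -/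
def slsMatrix :
    Matrix (Finset (Fin (n / 2))) (Finset (Fin (n / 2))) (MvPolynomial (degLEMonomials n) ℂ) :=
  Matrix.of fun S T => C (slsWeight n S T : ℂ) * X (slsCoord n S T)

/-- **The certificate against the diagonal depth-3 slice**: the determinant of the square-free
catalecticant. [cite: NisanWigderson1996, §3] -/
def slsCert : MvPolynomial (degLEMonomials n) ℂ := (slsMatrix n).det

/-- The explicit non-root: `F = Σ_S x^{2S}` over all subsets `S` of the first `⌊n/2⌋` variables
(degree `≤ n`). [folklore] -/
def sqWitness : MvPolynomial (Fin n) ℂ :=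
  ∑ S : Finset (Fin (n / 2)), monomial (ind n S + ind n S) 1

variable {n}

/-- Evaluating the certificate at a point of coefficient space. [folklore] -/
theorem eval_slsCert (g : degLEMonomials n → ℂ) :
    eval g (slsCert n) =
      (Matrix.of fun S T => (slsWeight n S T : ℂ) * g (slsCoord n S T)).det := by
  rw [slsCert, RingHom.map_det]
  congr 1
  ext S T
  simp [slsMatrix]

/-! ## Vanishing on the slice -/

/-- The square-free coefficient functional `g ↦ (g_{x^T})_T`. [folklore] -/
def sqfreeCoeffs (n : ℕ) : MvPolynomial (Fin n) ℂ →ₗ[ℂ] (Finset (Fin (n / 2)) → ℂ) where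
  toFun g := fun T => coeff (ind n T) g
  map_add' g h := by funext T; simp
  map_smul' c g := by funext T; simp

/-- The row of `S` in the evaluated certificate matrix is the square-free coefficient vector of
`x^S ⌟ f`. [cite: IarrobinoKanev1999, §1.1] -/
theorem row_eq_sqfreeCoeffs_apolarAction (f : MvPolynomial (Fin n) ℂ) (S : Finset (Fin (n / 2))) :
    (Matrix.of fun S T => (slsWeight n S T : ℂ) *
        coeffVector (degLEMonomials n) f (slsCoord n S T)) S =
      sqfreeCoeffs n (apolarAction (monomial (ind n S) 1) f) := by
  classical
  funext T
  rw [Matrix.of_apply, coeffVector_apply]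
  show (slsWeight n S T : ℂ) * coeff (ind n T + ind n S) f =
    coeff (ind n T) (apolarAction (monomial (ind n S) 1) f)
  rw [coeff_apolarAction_monomial_one, slsWeight, Nat.cast_prod, mul_comm]

/-- **The certificate vanishes on the diagonal depth-3 slice**: if
`Σ_i (d_i + 1) < 2^{⌊n/2⌋}` then `slsCert n` vanishes at `coeff (Σ_i c_i L_i^{d_i})`.
[cite: NisanWigderson1996, §3] -/
theorem eval_slsCert_eq_zero {s : ℕ} (c a₀ : Fin s → ℂ) (a : Fin s → Fin n → ℂ) (d : Fin s → ℕ)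
    (hd : ∑ i, (d i + 1) < 2 ^ (n / 2)) :
    eval (coeffVector (degLEMonomials n)
      (∑ i : Fin s, C (c i) *
        (C (a₀ i) + ∑ μ ∈ (Finset.univ : Finset (Fin n)), C (a i μ) * X μ) ^ (d i)))
      (slsCert n) = 0 := by
  classical
  obtain ⟨V, hfin, hrank, hV⟩ :=
    SuccinctHittingSetsForVP.stub_sigmaLambdaSigma (Fin n) s Finset.univ c a₀ a d
  haveI := hfin
  rw [eval_slsCert]
  refine det_eq_zero_of_rows_mem_submodule _ (V.map (sqfreeCoeffs n)) ?_ fun S => ?_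
  · calc Module.finrank ℂ (V.map (sqfreeCoeffs n)) ≤ Module.finrank ℂ V :=
          Submodule.finrank_map_le _ _
      _ < 2 ^ (n / 2) := lt_of_le_of_lt hrank hd
      _ = Fintype.card (Finset (Fin (n / 2))) := by rw [Fintype.card_finset, Fintype.card_fin]
  · rw [row_eq_sqfreeCoeffs_apolarAction]
    exact Submodule.mem_map_of_mem (hV _)

/-- Slice form of the vanishing: `slsCert n` vanishes on `sigmaLambdaSigmaSlice n s` whenever
`s (n + 1) < 2^{⌊n/2⌋}`. [cite: NisanWigderson1996, §3] -/
theorem eval_slsCert_eq_zero_of_mem {s : ℕ} (hs : s * (n + 1) < 2 ^ (n / 2))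
    {f : MvPolynomial (Fin n) ℂ} (hf : f ∈ sigmaLambdaSigmaSlice n s) :
    eval (coeffVector (degLEMonomials n) f) (slsCert n) = 0 := by
  obtain ⟨c, a₀, a, d, hdn, rfl⟩ := hf
  refine eval_slsCert_eq_zero c a₀ a d (lt_of_le_of_lt ?_ hs)
  calc ∑ i, (d i + 1) ≤ ∑ _i : Fin s, (n + 1) :=
        Finset.sum_le_sum fun i _ => by have := hdn i; omega
    _ = s * (n + 1) := by simp

end slice

end Summit.ValiantsHypothesis.ValiantsHypothesis.Theorems.BarrierLever.SigmaLambdaSigmaSlice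

end
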